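import Summits.CriticalPhenomena.PercolationContinuityZ3.Theorems.PercNearOneGluingNoHeavyLowerTailQuantitativeCshMarginWorldFloor
import Summits.CriticalPhenomena.PercolationContinuityZ3.Theorems.PercNearOneGluingNoHeavyConstsMDLXJointImpliesMDLX
import Summits.CriticalPhenomena.PercolationContinuityZ3.Theorems.PercNearOneGluingNoHeavyLowerTailQuantitativeHarrisInfluenceFloor
import HarnessLib

/-!
# An explicit floor for the CONDITIONED vdBHK covariance: `covD(f; u) ≥ μ(D)·∏_{e∩Y≠∅}(1−w_e)·Cov_{w_Y}(f(𝒞_x), 1{x↔u})`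
# (the lower half of BENCH row M2-R50: quantitative vdBHK Theorem 1.3, from the world-Harris decomposition)

Support file (`--supports stmt-CriticalPhenomena-4575`), prover seat `prim-rate-mine-2` (lane prim-rate, constants-miner (c), BENCH row
M2-R50 (lower half); `run/shared/lean/prim/prim-rate/prim-rate-mine-2/PROOFS.md` §P50).  No definitions, no named facts, no sorries; standard axioms.

`CSH.covD w x Y f u = μ(D)·∫_{D∩{x↔u}} f(𝒞_x) − (∫_D f(𝒞_x))·μ(D∩{x↔u})`, `D = {x ↮ Y}`, is `μ(D)²·Cov(f(𝒞_x), 1{x↔u} | x ↮ Y)` — the third piece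
(certificate C3) of the GEN peeling identity and the object of van den Berg–Häggström–Kahn's Theorem 1.3 (`Consts.covD_conn_nonneg`: `≥ 0`).
Its ZERO SET is that of the isolated covariance `Cov_{w_Y}(f(𝒞_x), 1{x↔u})` (`w_Y` = `w` zeroed on the pairs meeting `Y`; row M2-R46 (b)).  THIS
FILE makes the comparison quantitative:
* `CSH.covD_ge_worldHarris` — **`μ(D) · ∫_D Cov_{η}(f(𝒞_x(η ∖ A_Y(ω))), 1{x ↔ u in η ∖ A_Y(ω)}) dμ(ω) ≤ covD(f; u)`**, `A_Y(ω)` = the pairs meeting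
  the open cluster of `Y` in `ω` (the world-Harris floor of rows M2-R7/M2-R20 for a SINGLE marker: BHK's one-step decomposition
  `cov_D(f, χ_u) = P(D)·R(f, χ_u) + cov_D(𝒯f, χ_u)` (`BHK2006.covD_eq_withinD_add`) with `cov_D(𝒯f, χ_u) ≥ 0` by Theorem 1.3 itself applied to
  the monotone `𝒯f` (`Consts.covD_conn_nonneg`, `BHK2006.gibbsT_mono`));
* **`CSH.covD_ge_isolated`** — keeping only the world «all pairs at `Y` closed» (probability `∏_{e∩Y≠∅}(1−w_e)`, where `A_Y = ` the pairs
  meeting `Y` and the fresh law is `prodBernoulli w_Y`), every other world contributing `≥ 0` by Harris: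
  **`μ(D) · ∏_{e : ∃ y ∈ Y, y ∈ e} (1 − w_e) · (∫_{x↔u} f(𝒞_x) dμ_{w_Y} − (∫ f(𝒞_x) dμ_{w_Y})·μ_{w_Y}(x↔u)) ≤ covD w x Y f u`**.
With the two-cylinder floor (row M2-R49, `QuantHarris.cov_ge_prodPow_cyl_mul_jumps`) the right-most covariance is `≥ (p₀(1−p₀))^{|R|+1}·J`
from cylinder witnesses — an explicit LOCAL floor for the last non-explicit piece of block (A).  The UPPER half of row M2-R50
(`covD ≤ μ(D)·Cov_{w_Y}`, census-attained) is not proved here.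
[cite: VandenbergHaggstromKahn2005, Thm. 1.3 (p. 6), §2.1 Lemma 2.4 (p. 10)] [cite: Harris1960, Lemma 4.1 (p. 16)]
-/

noncomputable section

namespace Summit.CriticalPhenomena.PercolationContinuityZ3.Theorems.CSH

open MeasureTheory Set unitInterval
open Literature.Probability.LatticeModels (prodBernoulli prodBernoulli_real_forall_notMem)
open Literature.Probability.Percolation Literature.Probability.Percolation.KNPreFKG
open Literature.Probability.Percolation.BHK2006 (weight integral_prodBernoulli_eq_sum setCl setCl_singleton gibbsT gibbsT_mono withinD
  condS condCov covD_eq_withinD_add ite_mem_openEdgeCluster_eq_indicator openEdgeCluster_mono)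
open DecisionTree (ind ind_of_mem ind_of_not_mem ind_nonneg)
open scoped Classical

variable {V : Type*} [Fintype V]

/-! ### Sums versus integrals (the bookkeeping of `…QuantitativeCshMarginWorldFloor`, private there) -/

/-- Total mass of the product weights is `1`. [folklore] -/
private theorem sum_weight_eq_one₃ (w : Sym2 V → unitInterval) :
    ∑ ω : Set (Sym2 V), weight (fun e => (w e : ℝ)) ω = 1 := by
  have h1 := integral_prodBernoulli_eq_sum w fun _ => (1 : ℝ)
  simp only [integral_const, probReal_univ, smul_eq_mul, mul_one] at h1
  exact h1.symm

/-- `μ(D)` as a weighted sum. [folklore] -/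
private theorem real_D_eq_sum₃ (w : Sym2 V → unitInterval) (s : V) (X : Set V) :
    (prodBernoulli w).real {ω : BondConfig V | ∀ x ∈ X, ¬ (openGraph ω).Reachable s x} =
      ∑ ω, weight (fun e => (w e : ℝ)) ω *
        ind {ω : BondConfig V | ∀ x ∈ X, ¬ (openGraph ω).Reachable s x} ω := by
  rw [← integral_indicator_one (MeasurableSet.of_discrete), integral_prodBernoulli_eq_sum]
  refine Finset.sum_congr rfl fun ω _ => ?_
  by_cases hω : ω ∈ {ω : BondConfig V | ∀ x ∈ X, ¬ (openGraph ω).Reachable s x}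
  · rw [Set.indicator_of_mem hω, ind_of_mem hω, Pi.one_apply]
  · rw [Set.indicator_of_notMem hω, ind_of_not_mem hω, mul_zero]

/-- `∫_D ψ(C_s) dμ` as a weighted sum. [folklore] -/
private theorem setIntegral_D_eq_sum₃ (w : Sym2 V → unitInterval) (s : V) (X : Set V)
    (ψ : Set (Sym2 V) → ℝ) :
    ∫ ω in {ω : BondConfig V | ∀ x ∈ X, ¬ (openGraph ω).Reachable s x}, ψ (openEdgeCluster ω s)
        ∂(prodBernoulli w) =
      ∑ ω, weight (fun e => (w e : ℝ)) ω * (ψ (setCl ω {s}) *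
        ind {ω : BondConfig V | ∀ x ∈ X, ¬ (openGraph ω).Reachable s x} ω) := by
  rw [← integral_indicator (MeasurableSet.of_discrete), integral_prodBernoulli_eq_sum]
  refine Finset.sum_congr rfl fun ω _ => ?_
  rw [setCl_singleton]
  by_cases hω : ω ∈ {ω : BondConfig V | ∀ x ∈ X, ¬ (openGraph ω).Reachable s x}
  · rw [Set.indicator_of_mem hω, ind_of_mem hω, mul_one]
  · simp only [Set.indicator_of_notMem hω, ind_of_not_mem hω, mul_zero]

/-- `∫_D F · 1_A = ∫_{D ∩ A} F`. [folklore] -/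
private theorem setIntegral_mul_indicator_one₃ (μ : Measure (BondConfig V)) (D A : Set (BondConfig V))
    (F : BondConfig V → ℝ) :
    ∫ ω in D, F ω * A.indicator 1 ω ∂μ = ∫ ω in D ∩ A, F ω ∂μ := by
  have hA : MeasurableSet A := MeasurableSet.of_discrete
  have e : (fun ω => F ω * A.indicator (1 : BondConfig V → ℝ) ω) = A.indicator F := by
    funext ω
    by_cases hω : ω ∈ A
    · rw [Set.indicator_of_mem hω, Set.indicator_of_mem hω, Pi.one_apply, mul_one]
    · rw [Set.indicator_of_notMem hω, Set.indicator_of_notMem hω, mul_zero]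
  rw [e, setIntegral_indicator hA]

/-- `∫ F · 1_A = ∫_A F`. [folklore] -/
private theorem integral_mul_indicator_one₃ (μ : Measure (BondConfig V)) (A : Set (BondConfig V))
    (F : BondConfig V → ℝ) :
    ∫ ω, F ω * A.indicator 1 ω ∂μ = ∫ ω in A, F ω ∂μ := by
  have h := setIntegral_mul_indicator_one₃ μ Set.univ A F
  rwa [Measure.restrict_univ, Set.univ_inter] at h

/-- The measure form of BHK's denominator-free conditional covariance `cov_D(φ, h)`. [cite: VandenbergHaggstromKahn2005, Thm. 1.5 eq. (9) (p. 7)] -/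
private theorem covD_sum_eq₃ (w : Sym2 V → unitInterval) (s : V) (X : Set V) (φ h : Set (Sym2 V) → ℝ) :
    BHK2006.covD (fun e => (w e : ℝ)) {s} {ω : BondConfig V | ∀ x ∈ X, ¬ (openGraph ω).Reachable s x} φ h =
      (prodBernoulli w).real {ω : BondConfig V | ∀ x ∈ X, ¬ (openGraph ω).Reachable s x} *
          (∫ ω in {ω : BondConfig V | ∀ x ∈ X, ¬ (openGraph ω).Reachable s x},
            φ (openEdgeCluster ω s) * h (openEdgeCluster ω s) ∂(prodBernoulli w)) -
        (∫ ω in {ω : BondConfig V | ∀ x ∈ X, ¬ (openGraph ω).Reachable s x}, φ (openEdgeCluster ω s) ∂(prodBernoulli w)) *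
          (∫ ω in {ω : BondConfig V | ∀ x ∈ X, ¬ (openGraph ω).Reachable s x}, h (openEdgeCluster ω s) ∂(prodBernoulli w)) := by
  rw [BHK2006.covD, real_D_eq_sum₃ w s X, setIntegral_D_eq_sum₃ w s X (fun C => φ C * h C),
    setIntegral_D_eq_sum₃ w s X φ, setIntegral_D_eq_sum₃ w s X h]

/-- The measure form of BHK's averaged one-step covariance `R(φ,h)`. [cite: VandenbergHaggstromKahn2005, §2.1 Lemma 2.4 (p. 10)] -/
private theorem withinD_sum_eq₃ (w : Sym2 V → unitInterval) (s : V) (X : Set V) (φ h : Set (Sym2 V) → ℝ) :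
    withinD (fun e => (w e : ℝ)) {s} X {ω : BondConfig V | ∀ x ∈ X, ¬ (openGraph ω).Reachable s x} φ h =
      ∫ ω in {ω : BondConfig V | ∀ x ∈ X, ¬ (openGraph ω).Reachable s x},
        ((∫ η, φ (openEdgeCluster (η \ {e | ∃ v ∈ e, ∃ x ∈ X, (openGraph ω).Reachable x v}) s) *
              h (openEdgeCluster (η \ {e | ∃ v ∈ e, ∃ x ∈ X, (openGraph ω).Reachable x v}) s) ∂(prodBernoulli w)) -
          (∫ η, φ (openEdgeCluster (η \ {e | ∃ v ∈ e, ∃ x ∈ X, (openGraph ω).Reachable x v}) s) ∂(prodBernoulli w)) *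
          (∫ η, h (openEdgeCluster (η \ {e | ∃ v ∈ e, ∃ x ∈ X, (openGraph ω).Reachable x v}) s) ∂(prodBernoulli w)))
        ∂(prodBernoulli w) := by
  rw [withinD, ← integral_indicator (MeasurableSet.of_discrete), integral_prodBernoulli_eq_sum]
  refine Finset.sum_congr rfl fun ω _ => ?_
  by_cases hω : ω ∈ {ω : BondConfig V | ∀ x ∈ X, ¬ (openGraph ω).Reachable s x}
  · rw [Set.indicator_of_mem hω, ind_of_mem hω, mul_one, condCov,
      BHK2006.integral_sdiff_eq_condS w s X (fun A => φ A * h A) ω, BHK2006.integral_sdiff_eq_condS w s X φ ω,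
      BHK2006.integral_sdiff_eq_condS w s X h ω]
  · simp only [Set.indicator_of_notMem hω, ind_of_not_mem hω, mul_zero]

/-! ### `CSH.covD` is BHK's `cov_D(f, χ_u)` -/

/-- **`CSH.covD w x Y f u = cov_D(f, χ_u)`** with `χ_u = connIndicatorFn x u` (`1{u ∈ V(𝒞_x)}`). [cite: VandenbergHaggstromKahn2005, Thm. 1.5 eq. (9) (p. 7)] -/
theorem covD_eq_bhkCovD (w : Sym2 V → unitInterval) (x : V) (Y : Set V) (f : Set (Sym2 V) → ℝ) (u : V) :
    covD w x Y f u =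
      BHK2006.covD (fun e => (w e : ℝ)) {x} {ω : BondConfig V | ∀ y ∈ Y, ¬ (openGraph ω).Reachable x y} f (connIndicatorFn x u) := by
  rw [covD_sum_eq₃]
  simp only [connIndicatorFn_openEdgeCluster]
  rw [setIntegral_mul_indicator_one₃, setIntegral_indicator_one_eq]
  unfold covD
  rfl

/-! ### The world-Harris floor of `covD` (one marker) -/

/-- **World-Harris floor of the conditioned covariance.**  ANY weights in `[0,1]`, `x ∉ Y`, `f` monotone on edge clusters, any `u`:
`μ(D) · ∫_D [ E_η(f·χ_u)(𝒞_x(η ∖ A_Y(ω))) − E_η f(…) · E_η χ_u(…) ] dμ(ω) ≤ covD w x Y f u`, `A_Y(ω)` = the pairs meeting the open cluster of `Y`.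
(BHK's one-step decomposition + Theorem 1.3 for `𝒯f`.) [cite: VandenbergHaggstromKahn2005, Thm. 1.3 (p. 6), §2.1 Lemma 2.4 (p. 10)] -/
theorem covD_ge_worldHarris (w : Sym2 V → unitInterval) (x : V) (Y : Set V) (hxY : x ∉ Y)
    (u : V) (f : Set (Sym2 V) → ℝ) (hf : Monotone f) :
    (prodBernoulli w).real {ω : BondConfig V | ∀ y ∈ Y, ¬ (openGraph ω).Reachable x y} *
        ∫ ω in {ω : BondConfig V | ∀ y ∈ Y, ¬ (openGraph ω).Reachable x y},
          ((∫ η, f (openEdgeCluster (η \ {e | ∃ v ∈ e, ∃ y ∈ Y, (openGraph ω).Reachable y v}) x) *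
                connIndicatorFn x u (openEdgeCluster (η \ {e | ∃ v ∈ e, ∃ y ∈ Y, (openGraph ω).Reachable y v}) x) ∂(prodBernoulli w)) -
            (∫ η, f (openEdgeCluster (η \ {e | ∃ v ∈ e, ∃ y ∈ Y, (openGraph ω).Reachable y v}) x) ∂(prodBernoulli w)) *
            (∫ η, connIndicatorFn x u (openEdgeCluster (η \ {e | ∃ v ∈ e, ∃ y ∈ Y, (openGraph ω).Reachable y v}) x) ∂(prodBernoulli w)))
          ∂(prodBernoulli w) ≤
      covD w x Y f u := by
  have hw0 : ∀ e, 0 ≤ ((w e : unitInterval) : ℝ) := fun e => (w e).2.1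
  have hw1 : ∀ e, ((w e : unitInterval) : ℝ) ≤ 1 := fun e => (w e).2.2
  have hD : ∀ ω : BondConfig V, ω ∈ {ω : BondConfig V | ∀ y ∈ Y, ¬ (openGraph ω).Reachable x y} ↔
      ∀ s ∈ ({x} : Set V), ∀ t ∈ Y, ¬ (openGraph ω).Reachable s t := fun ω => by
    simp only [Set.mem_setOf_eq, Set.mem_singleton_iff, forall_eq]
  have hid := covD_eq_withinD_add (fun e => (w e : ℝ)) (sum_weight_eq_one₃ w) {x} Y hD f (connIndicatorFn x u)
  have hT : 0 ≤ covD w x Y (gibbsT (fun e => (w e : ℝ)) {x} Y f) u :=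
    Consts.covD_conn_nonneg w x Y hxY _ (gibbsT_mono hw0 hw1 {x} Y hf) u
  rw [covD_eq_bhkCovD] at hT
  rw [covD_eq_bhkCovD, hid, ← real_D_eq_sum₃, withinD_sum_eq₃]
  linarith

/-! ### The isolated world: all pairs at `Y` closed -/

omit [Fintype V] in
/-- If every pair at `Y` is closed then nothing but `y` is reachable from `y ∈ Y`. [folklore] -/
theorem eq_of_reachable_of_closed_at {ω : BondConfig V} {Y : Set V} (hZ : ∀ e ∈ ω, ∀ y ∈ Y, y ∉ e) {y v : V} (hy : y ∈ Y)
    (h : (openGraph ω).Reachable y v) : v = y := by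
  by_contra hne
  obtain ⟨p⟩ := h
  cases p with
  | nil => exact hne rfl
  | cons hadj _ =>
    rw [openGraph_adj] at hadj
    exact hZ _ hadj.1 y hy (Sym2.mem_mk_left _ _)

/-- **Explicit floor for the conditioned vdBHK covariance (row M2-R50, lower half).**  ANY weights in `[0,1]`, `x ∉ Y`, `f` monotone and
nonnegative on edge clusters, any `u`; `w_Y` = `w` zeroed on the pairs meeting `Y`:
`μ(D) · ∏_{e : ∃ y ∈ Y, y ∈ e} (1 − w_e) · (∫_{x↔u} f(𝒞_x) dμ_{w_Y} − (∫ f(𝒞_x) dμ_{w_Y}) · μ_{w_Y}(x↔u)) ≤ covD w x Y f u`.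
[cite: VandenbergHaggstromKahn2005, Thm. 1.3 (p. 6), §2.1 Lemma 2.4 (p. 10)] [cite: Harris1960, Lemma 4.1 (p. 16)] -/
theorem covD_ge_isolated (w : Sym2 V → unitInterval) (x : V) (Y : Set V) (hxY : x ∉ Y)
    (u : V) (f : Set (Sym2 V) → ℝ) (hf : Monotone f) (hf0 : ∀ C, 0 ≤ f C) :
    (prodBernoulli w).real {ω : BondConfig V | ∀ y ∈ Y, ¬ (openGraph ω).Reachable x y} *
        (∏ e ∈ Finset.univ.filter (fun e : Sym2 V => ∃ y ∈ Y, y ∈ e), (1 - (w e : ℝ))) *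
        ((∫ η in openConn x u, f (openEdgeCluster η x)
            ∂(prodBernoulli fun e => if (∃ y ∈ Y, y ∈ e) then (0 : unitInterval) else w e)) -
          (∫ η, f (openEdgeCluster η x) ∂(prodBernoulli fun e => if (∃ y ∈ Y, y ∈ e) then (0 : unitInterval) else w e)) *
            (prodBernoulli fun e => if (∃ y ∈ Y, y ∈ e) then (0 : unitInterval) else w e).real (openConn x u)) ≤
      covD w x Y f u := by
  set μ := prodBernoulli w with hμ
  set D : Set (BondConfig V) := {ω | ∀ y ∈ Y, ¬ (openGraph ω).Reachable x y} with hD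
  set MY : Finset (Sym2 V) := Finset.univ.filter (fun e : Sym2 V => ∃ y ∈ Y, y ∈ e) with hMY
  set M : Set (Sym2 V) := {e | ∃ y ∈ Y, y ∈ e} with hM
  set wY : Sym2 V → unitInterval := fun e => if (∃ y ∈ Y, y ∈ e) then (0 : unitInterval) else w e with hwY
  set Z : Set (BondConfig V) := {ω | ∀ e ∈ MY, e ∉ ω} with hZ
  have hworld := covD_ge_worldHarris w x Y hxY u f hf
  -- the bracket of a world
  set B : BondConfig V → ℝ := fun ω =>
    (∫ η, f (openEdgeCluster (η \ {e | ∃ v ∈ e, ∃ y ∈ Y, (openGraph ω).Reachable y v}) x) *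
          connIndicatorFn x u (openEdgeCluster (η \ {e | ∃ v ∈ e, ∃ y ∈ Y, (openGraph ω).Reachable y v}) x) ∂μ) -
      (∫ η, f (openEdgeCluster (η \ {e | ∃ v ∈ e, ∃ y ∈ Y, (openGraph ω).Reachable y v}) x) ∂μ) *
      (∫ η, connIndicatorFn x u (openEdgeCluster (η \ {e | ∃ v ∈ e, ∃ y ∈ Y, (openGraph ω).Reachable y v}) x) ∂μ) with hB
  -- every bracket is nonnegative (Harris for the two monotone functions of `η`)
  have hB0 : ∀ ω, 0 ≤ B ω := by
    intro ω
    set A : Set (Sym2 V) := {e | ∃ v ∈ e, ∃ y ∈ Y, (openGraph ω).Reachable y v} with hA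
    have hFm : Monotone (fun η : Set (Sym2 V) => f (openEdgeCluster (η \ A) x)) :=
      fun η η' h => hf (openEdgeCluster_mono (Set.sdiff_subset_sdiff_left h) x)
    have hGm : Monotone (fun η : Set (Sym2 V) => connIndicatorFn x u (openEdgeCluster (η \ A) x)) :=
      fun η η' h => monotone_connIndicatorFn x u (openEdgeCluster_mono (Set.sdiff_subset_sdiff_left h) x)
    have hG0 : ∀ η : Set (Sym2 V), 0 ≤ connIndicatorFn x u (openEdgeCluster (η \ A) x) := fun η => by
      unfold connIndicatorFn; split_ifs; exacts [zero_le_one, le_rfl]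
    obtain ⟨e0⟩ : Nonempty (Sym2 V) := ⟨s(x, x)⟩
    have h := QuantHarris.influence_mul_influence_le_cov_prodBernoulli w e0
      (fun η : Set (Sym2 V) => f (openEdgeCluster (η \ A) x)) (fun η => connIndicatorFn x u (openEdgeCluster (η \ A) x))
      (fun _ => hf0 _) hG0 hFm hGm
    have hl : 0 ≤ (w e0 : ℝ) * (1 - w e0) *
        ((∫ η, (f (openEdgeCluster ((insert e0 η) \ A) x) - f (openEdgeCluster ((η \ {e0}) \ A) x)) ∂μ) *
          ∫ η, (connIndicatorFn x u (openEdgeCluster ((insert e0 η) \ A) x) -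
            connIndicatorFn x u (openEdgeCluster ((η \ {e0}) \ A) x)) ∂μ) := by
      refine mul_nonneg (mul_nonneg (w e0).2.1 (sub_nonneg.2 (w e0).2.2)) (mul_nonneg ?_ ?_)
      · exact integral_nonneg fun η => sub_nonneg.2 (hFm ((Set.sdiff_subset).trans (Set.subset_insert e0 η)))
      · exact integral_nonneg fun η => sub_nonneg.2 (hGm ((Set.sdiff_subset).trans (Set.subset_insert e0 η)))
    simp only [hB]
    linarith
  -- the isolated world `Z`: there `A_Y(ω) = M`
  have hZD : Z ⊆ D := by
    intro ω hω y hy hr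
    have hcl : ∀ e ∈ ω, ∀ y ∈ Y, y ∉ e := fun e he y' hy' hye =>
      hω e (Finset.mem_filter.2 ⟨Finset.mem_univ e, y', hy', hye⟩) he
    exact hxY ((eq_of_reachable_of_closed_at hcl hy hr.symm) ▸ hy)
  have hAZ : ∀ ω ∈ Z, {e : Sym2 V | ∃ v ∈ e, ∃ y ∈ Y, (openGraph ω).Reachable y v} = M := by
    intro ω hω
    have hcl : ∀ e ∈ ω, ∀ y ∈ Y, y ∉ e := fun e he y' hy' hye =>
      hω e (Finset.mem_filter.2 ⟨Finset.mem_univ e, y', hy', hye⟩) he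
    ext e
    simp only [hM, Set.mem_setOf_eq]
    constructor
    · rintro ⟨v, hve, y, hy, hr⟩
      exact ⟨y, hy, (eq_of_reachable_of_closed_at hcl hy hr) ▸ hve⟩
    · rintro ⟨y, hy, hye⟩
      exact ⟨y, hye, y, hy, SimpleGraph.Reachable.refl _⟩
  -- the bracket on `Z` is the `w_Y`-covariance
  have hM0 : ∀ e ∈ M, wY e = 0 := fun e he => by simp only [hwY]; exact if_pos he
  have hM1 : ∀ e ∉ M, wY e = w e := fun e he => by simp only [hwY]; exact if_neg he
  set BY : ℝ := (∫ η in openConn x u, f (openEdgeCluster η x) ∂(prodBernoulli wY)) -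
      (∫ η, f (openEdgeCluster η x) ∂(prodBernoulli wY)) * (prodBernoulli wY).real (openConn x u) with hBY
  have hBZ : ∀ ω ∈ Z, B ω = BY := by
    intro ω hω
    simp only [hB, hAZ ω hω]
    rw [BHK2006.integral_comp_sdiff_prodBernoulli' w wY M hM0 hM1
        (fun η => f (openEdgeCluster η x) * connIndicatorFn x u (openEdgeCluster η x)),
      BHK2006.integral_comp_sdiff_prodBernoulli' w wY M hM0 hM1 (fun η => f (openEdgeCluster η x)),
      BHK2006.integral_comp_sdiff_prodBernoulli' w wY M hM0 hM1 (fun η => connIndicatorFn x u (openEdgeCluster η x))]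
    simp only [connIndicatorFn_openEdgeCluster]
    rw [integral_mul_indicator_one₃, integral_indicator_one (MeasurableSet.of_discrete)]
  -- `∫_D B ≥ ∫_Z B = μ(Z) · BY`, `μ(Z) = ∏ (1 − w)`
  have hZmeas : MeasurableSet Z := MeasurableSet.of_discrete
  have hint : ∫ ω in Z, B ω ∂μ ≤ ∫ ω in D, B ω ∂μ :=
    setIntegral_mono_set (Integrable.of_finite) (Filter.Eventually.of_forall fun ω => hB0 ω)
      (Filter.Eventually.of_forall hZD)
  have hZval : ∫ ω in Z, B ω ∂μ = μ.real Z * BY := by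
    rw [setIntegral_congr_fun hZmeas (fun ω hω => hBZ ω hω), setIntegral_const, smul_eq_mul]
  have hZmass : μ.real Z = ∏ e ∈ MY, (1 - (w e : ℝ)) := prodBernoulli_real_forall_notMem w MY
  have hDn : 0 ≤ μ.real D := measureReal_nonneg
  have hmain : μ.real D * (μ.real Z * BY) ≤ covD w x Y f u := by
    have h1 : μ.real D * (μ.real Z * BY) ≤ μ.real D * ∫ ω in D, B ω ∂μ :=
      mul_le_mul_of_nonneg_left (by rw [← hZval]; exact hint) hDn
    exact h1.trans hworld
  rw [hZmass] at hmain
  calc μ.real D * (∏ e ∈ MY, (1 - (w e : ℝ))) * BY = μ.real D * ((∏ e ∈ MY, (1 - (w e : ℝ))) * BY) := by ring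
    _ ≤ covD w x Y f u := hmain

end Summit.CriticalPhenomena.PercolationContinuityZ3.Theorems.CSH

end
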